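import Summits.AnomalousDissipation.AnomalousDissipation.Theorems.KolmogorovFloor.Negative.Rest
import Summits.AnomalousDissipation.AnomalousDissipation.Theorems.KolmogorovFloor.Negative.AxisBeatOffset
import Summits.AnomalousDissipation.AnomalousDissipation.Theorems.KolmogorovFloor.Negative.LaminarBeat
import Summits.AnomalousDissipation.AnomalousDissipation.Theorems.KolmogorovFloor.Negative.BelowTaylorSupport

/-!
# The energy channel of `KolmogorovFloor` cannot bear load: `|θ₁(ν)| = O(ν^{1/4})` (negative side, stmt-14030)

cdisprove seat `refuter-cdisprove-stmt-AnomalousDissipation-14030-0` (2026-08-16).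

For ANY smooth divergence-free mean-zero force `f`, floor `ε₀ > 0` and constants `C, Θ` there are `K, ν₁ > 0` such
that every floor datum `(N, Φ₁, θ₁)` of the crux's shape at a viscosity `ν < ν₁` (`N ≤ Cν^{-3/4}`, band-limited
test fields, `−Θ ≤ θ₁ ≤ 0`, the floor on the finite-enstrophy part of the Leray ball) has `|θ₁| ≤ K ν^{1/4}`
(`kolmogorovFloor_weights_vanish`). So in every witness of `KolmogorovFloor` the energy-channel weight tends to
zero: the parameter `Θ` is decoration, and a certificate must be designed with `θ₁ = 0` up to `O(ν^{1/4})`.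
Witness: the LAMINAR RAY `z₀ = s·f̂(k₀)` (`f̂(k₀) ≠ 0`; a single transversal mode is a steady Euler flow) with
`s = min(|θ₁|,1)/((1+2Θ)8π²L₀²ν)`: there the energy channel creates the deficit `≥ |θ₁| min(|θ₁|,1)‖f̂(k₀)‖²/((1+2Θ)8π²L₀²ν)`,
which the multiplier at the laminar state can only pay through a resolved coefficient that the axis-carrier beat
(`axis_beat_data_offset`, carriers separated from `±k₀`) cashes at price `≲ (1+2Θ)C²ν^{-1/2}`; the Wiener bound
controls the injection, `laplacian_base_le` the drift. Sorry-free; toolkit `Negative/{ThreeModesBase, LaminarBeat,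
AxisBeat(Offset), BelowTaylorSupport, Rest}.lean` and `Theorems/TaylorCertificatePair/Negative/*`.
-/

noncomputable section

open MeasureTheory UnitAddTorus Matrix
open scoped InnerProductSpace ENNReal ComplexConjugate

namespace Summit.AnomalousDissipation.AnomalousDissipation.Theorems.KolmogorovFloor.Negative

open Literature.Analysis.FunctionSpaces Literature.Analysis.FluidPDE
open Summit.AnomalousDissipation.AnomalousDissipation.Theorems.TaylorCertificatePair.Negative

set_option maxHeartbeats 400000 in
/-- **The energy channel cannot bear load.** For any smooth div-free mean-zero `f`, `ε₀ > 0`, `C`, `Θ` there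
are `K, ν₁ > 0` such that every floor datum of the crux's shape at `ν < ν₁` has `|θ₁| ≤ K ν^{1/4}`. -/
theorem kolmogorovFloor_weights_vanish
    {f : (UnitAddTorus (Fin 3)) → (EuclideanSpace ℝ (Fin 3))} (hf : Torus.IsSmooth f) (hfd : Torus.IsDivFree f)
    (hfz : Torus.HasZeroMean f) {ε₀ : ℝ} (C Θ : ℝ) (hε₀ : 0 < ε₀) :
    ∃ K ν₁ : ℝ, 0 < K ∧ 0 < ν₁ ∧ ∀ ν : ℝ, 0 < ν → ν < ν₁ →
      ∀ (N : ℕ) (Φ₁ : Torus.CylindricalTest (Fin 3)) (θ₁ : ℝ), (N : ℝ) ≤ C * ν ^ (-(3 / 4 : ℝ)) →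
        (∀ i, Torus.fourierTruncate N (Φ₁.g i) = Φ₁.g i) → -Θ ≤ θ₁ → θ₁ ≤ 0 →
        (∀ u : Literature.Analysis.FunctionSpaces.Torus.energySpace (Fin 3), let uf : UnitAddTorus (Fin 3) → EuclideanSpace ℝ (Fin 3) := ((u : MeasureTheory.Lp (EuclideanSpace ℝ (Fin 3)) 2 (MeasureTheory.volume : MeasureTheory.Measure (UnitAddTorus (Fin 3)))) : UnitAddTorus (Fin 3) → EuclideanSpace ℝ (Fin 3)); let D : ℝ := ν * (Literature.Analysis.FunctionSpaces.Torus.eGradNormSq uf).toReal; let P : ℝ := Literature.Analysis.FluidPDE.Torus.pairing (u : MeasureTheory.Lp (EuclideanSpace ℝ (Fin 3)) 2 (MeasureTheory.volume : MeasureTheory.Measure (UnitAddTorus (Fin 3)))) f - D; Literature.Analysis.FunctionSpaces.Torus.eGradNormSq uf ≠ ⊤ → ‖u‖ ^ 2 ≤ 16 * (∫ x, ‖f x‖ ^ 2) / ν ^ 2 → ε₀ ≤ D + Literature.Analysis.FluidPDE.Torus.nsGeneratorPairing ν f u (Φ₁.grad u) + 2 * θ₁ * P) → |θ₁| ≤ K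 * ν ^ (1 / 4 : ℝ) := by
  have hF2nn : 0 ≤ ∫ x, ‖f x‖ ^ 2 := integral_nonneg fun x => by positivity
  by_cases hF0 : ∫ x, ‖f x‖ ^ 2 = 0
  · /- a vanishing force admits no floor datum at all (floor at rest) -/
    refine ⟨1, 1, one_pos, one_pos, fun ν hν _ N Φ₁ θ₁ _ _ _ _ hu => ?_⟩
    exfalso
    have hinj := rest_injects hν hu
    have hae := ae_zero_of_integral_sq_zero hf hF0
    have hzero : (∫ x, ⟪f x, Φ₁.grad 0 x⟫_ℝ) = 0 := by
      rw [← integral_zero (α := (UnitAddTorus (Fin 3))) (G := ℝ)]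
      refine integral_congr_ae ?_
      filter_upwards [hae] with x hx
      simp [hx]
    linarith only [hinj, hzero, hε₀]
  have hF2pos : 0 < ∫ x, ‖f x‖ ^ 2 := lt_of_le_of_ne hF2nn (Ne.symm hF0)
  obtain ⟨F, hFdef⟩ : ∃ F : ℝ, F = Real.sqrt (∫ x, ‖f x‖ ^ 2) := ⟨_, rfl⟩
  have hF : 0 < F := by rw [hFdef]; exact Real.sqrt_pos.2 hF2pos
  have hFsq : F ^ 2 = ∫ x, ‖f x‖ ^ 2 := by rw [hFdef]; exact Real.sq_sqrt hF2nn
  /- the gravest active mode of the force -/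
  obtain ⟨k₀, hk₀⟩ := exists_mFourierCoeff_ne_zero hf hF2pos
  have hk0 : k₀ ≠ 0 := by
    rintro rfl
    exact hk₀ (Torus.mFourierCoeff_complexify_zero_of_hasZeroMean hf.integrable hfz)
  obtain ⟨φ, hφdef⟩ : ∃ φ : ℝ, φ = ‖mFourierCoeff (EuclideanSpace.complexify ∘ f) k₀‖ := ⟨_, rfl⟩
  have hφ : 0 < φ := by rw [hφdef]; exact norm_pos_iff.2 hk₀
  have hφF : φ ≤ F := by rw [hφdef, hFdef]; exact norm_fc_le_sqrt_integral (hf.memLp 2) k₀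
  have hfq1 : 1 ≤ Torus.freqNormSq k₀ := Torus.one_le_freqNormSq_of_ne_zero hk0
  obtain ⟨K₀, hK₀def⟩ : ∃ K₀ : ℕ, K₀ = ⌈Torus.freqNormSq k₀⌉₊ := ⟨_, rfl⟩
  have hK₀ : Torus.freqNormSq k₀ ≤ (K₀ : ℝ) := by rw [hK₀def]; exact Nat.le_ceil _
  have hK₀1 : (1 : ℝ) ≤ K₀ := hfq1.trans hK₀
  have hkj : ∀ j, ((k₀ j : ℝ)) ^ 2 ≤ (K₀ : ℝ) ^ 2 := fun j =>
    ((sq_apply_le_freqNormSq k₀ j).trans hK₀).trans (le_self_pow₀ hK₀1 two_ne_zero)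
  have hkL : Torus.freqNormSq k₀ ≤ (K₀ : ℝ) ^ 2 := hK₀.trans (le_self_pow₀ hK₀1 two_ne_zero)
  /- constants -/
  obtain ⟨A, hAdef⟩ : ∃ A : ℝ, A = ∑' κ, ‖mFourierCoeff (EuclideanSpace.complexify ∘ f) κ‖ := ⟨_, rfl⟩
  have hA0 : 0 ≤ A := by rw [hAdef]; exact tsum_nonneg fun κ => norm_nonneg _
  obtain ⟨α, hαdef⟩ : ∃ α : ℝ, α = Real.sqrt (10 / 9 * (A + φ + 1)) := ⟨_, rfl⟩
  have hα : 0 < α := by rw [hαdef]; exact Real.sqrt_pos.2 (by positivity)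
  have hα2 : α ^ 2 = 10 / 9 * (A + φ + 1) := by rw [hαdef, Real.sq_sqrt]; positivity
  obtain ⟨C', hC'⟩ : ∃ C' : ℝ, C' = max C 1 := ⟨_, rfl⟩
  have hC'1 : 1 ≤ C' := by rw [hC']; exact le_max_right _ _
  obtain ⟨Θ', hΘ'⟩ : ∃ Θ' : ℝ, Θ' = max Θ 0 := ⟨_, rfl⟩
  have hΘ'0 : 0 ≤ Θ' := by rw [hΘ']; exact le_max_right _ _
  obtain ⟨c, hcdef⟩ : ∃ c : ℝ, c = 5 + 2 * K₀ := ⟨_, rfl⟩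
  have hc0 : 0 < c := by rw [hcdef]; positivity
  obtain ⟨M, hMdef⟩ : ∃ M : ℝ, M = (1 + 2 * Θ') ^ 2 * (256 * Real.pi ^ 4) * (K₀ : ℝ) ^ 2 * c ^ 2 * α ^ 2 * C' ^ 2 / φ ^ 2 := ⟨_, rfl⟩
  have hM0 : 0 < M := by rw [hMdef]; positivity
  refine ⟨Real.sqrt M + 1, min (min 1 (F / (2 * α))) (1 / (M + 1) ^ 2), by positivity,
    lt_min (lt_min one_pos (by positivity)) (by positivity), ?_⟩
  intro ν hν hνν₁ N Φ₁ θ₁ hN hband hθ₁ hθ₁' hu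
  have hν1 : ν ≤ 1 := (le_min_iff.1 (le_min_iff.1 hνν₁.le).1).1
  have hνa : ν ≤ F / (2 * α) := (le_min_iff.1 (le_min_iff.1 hνν₁.le).1).2
  have hνb : ν < 1 / (M + 1) ^ 2 := lt_of_lt_of_le hνν₁ (min_le_right _ _)
  by_contra hcon
  push Not at hcon
  set θ : ℝ := |θ₁| with hθdef
  have hθpos : 0 < θ := lt_of_le_of_lt (by positivity) hcon
  have hθeq : θ = -θ₁ := by rw [hθdef]; exact abs_of_nonpos hθ₁'
  have hΘ : 0 ≤ Θ := by linarith only [hθ₁, hθ₁']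
  have hΘeq : Θ' = Θ := by rw [hΘ']; exact max_eq_left hΘ
  have hN0 : (0 : ℝ) ≤ N := Nat.cast_nonneg N
  have hNs : (N : ℝ) ≤ C' * ν ^ (-(3 / 4 : ℝ)) := by
    refine hN.trans (mul_le_mul_of_nonneg_right ?_ (Real.rpow_nonneg hν.le _))
    rw [hC']; exact le_max_left _ _
  /- the laminar ray -/
  obtain ⟨σ, hσdef⟩ : ∃ σ : ℝ, σ = min θ 1 := ⟨_, rfl⟩
  have hσ0 : 0 < σ := by rw [hσdef]; exact lt_min hθpos one_pos
  have hσθ : σ ≤ θ := by rw [hσdef]; exact min_le_left _ _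
  have hσ1 : σ ≤ 1 := by rw [hσdef]; exact min_le_right _ _
  obtain ⟨den, hdendef⟩ : ∃ den : ℝ, den = (1 + 2 * Θ) * (8 * Real.pi ^ 2) * (K₀ : ℝ) ^ 2 * ν := ⟨_, rfl⟩
  have hden : 0 < den := by rw [hdendef]; positivity
  obtain ⟨s, hsdef⟩ : ∃ s : ℝ, s = σ / den := ⟨_, rfl⟩
  have hs0 : 0 < s := by rw [hsdef]; positivity
  have hsden : s * den = σ := by rw [hsdef, div_mul_cancel₀ _ hden.ne']
  set fk : (EuclideanSpace ℂ (Fin 3)) := mFourierCoeff (EuclideanSpace.complexify ∘ f) k₀ with hfkdef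
  set z₀ : (EuclideanSpace ℂ (Fin 3)) := ((s : ℝ) : ℂ) • fk with hz₀def
  have hzn : ‖z₀‖ = s * φ := by
    rw [hz₀def, norm_smul, Complex.norm_real, Real.norm_of_nonneg hs0.le, hφdef]
  have htrans : ((fun j => ((k₀) j : ℂ)) ⬝ᵥ (WithLp.ofLp (z₀))) = 0 := by
    have h0 : ((fun j => ((k₀) j : ℂ)) ⬝ᵥ (WithLp.ofLp (fk))) = 0 := hfd.sum_mul_mFourierCoeff_eq_zero hf k₀
    rw [hz₀def, dotc_smul, h0, mul_zero]
  have hP₀ : (⟪z₀, (mFourierCoeff (EuclideanSpace.complexify ∘ f) k₀)⟫_ℂ).re = s * φ ^ 2 := by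
    have h1 : ⟪z₀, fk⟫_ℂ = (s : ℂ) * ⟪fk, fk⟫_ℂ := by
      rw [hz₀def, inner_smul_left, Complex.conj_ofReal]
    have h2 : (⟪fk, fk⟫_ℂ).re = ‖fk‖ ^ 2 := by
      have := inner_self_eq_norm_sq (𝕜 := ℂ) fk
      simpa using this
    rw [← hfkdef, h1, Complex.re_ofReal_mul, h2, hφdef]
  obtain ⟨ub, hub⟩ := exists_state ![k₀] ![z₀] (fun m => by fin_cases m; exact hk0) (fun m => by fin_cases m; exact htrans)
  /- the multiplier at the laminar state, its largest coefficient, Wiener and drift bounds -/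
  obtain ⟨G, hGdef⟩ : ∃ G : (UnitAddTorus (Fin 3)) → (EuclideanSpace ℝ (Fin 3)), G = Φ₁.grad ub := ⟨_, rfl⟩
  have hG : Torus.IsSmooth G := by rw [hGdef]; exact isSmooth_grad Φ₁ ub
  have hbandG : ∀ κ, (N : ℝ) ^ 2 < Torus.freqNormSq κ → mFourierCoeff (EuclideanSpace.complexify ∘ G) κ = 0 := by
    rw [hGdef]; exact fc_grad_eq_zero Φ₁ hband ub
  obtain ⟨q, hqmem, hqmax⟩ := Finset.exists_max_image (Torus.freqBall (d := Fin 3) N)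
    (fun κ => ‖(mFourierCoeff (EuclideanSpace.complexify ∘ G) κ)‖) ⟨0, Torus.zero_mem_freqBall N⟩
  obtain ⟨g, hgdef⟩ : ∃ g : (EuclideanSpace ℂ (Fin 3)), g = (mFourierCoeff (EuclideanSpace.complexify ∘ G) q) := ⟨_, rfl⟩
  have hfG : ∫ x, ⟪f x, G x⟫_ℝ ≤ A * ‖g‖ := by
    rw [hAdef, hgdef]; exact integral_inner_le_tsum_mul_max hf hG.continuous hbandG hqmax
  have hGk : ‖(mFourierCoeff (EuclideanSpace.complexify ∘ G) k₀)‖ ≤ ‖g‖ := by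
    by_cases hkin : Torus.freqNormSq k₀ ≤ (N : ℝ) ^ 2
    · rw [hgdef]; exact hqmax k₀ (Torus.mem_freqBall.2 hkin)
    · rw [hbandG k₀ (lt_of_not_ge hkin), norm_zero]; exact norm_nonneg _
  have hlap : ν * (⟪z₀, -(((4 * Real.pi ^ 2 * Torus.freqNormSq k₀ : ℝ) : ℂ) • (mFourierCoeff (EuclideanSpace.complexify ∘ G) k₀))⟫_ℂ).re ≤ φ * ‖g‖ := by
    have h1 := laplacian_base_le k₀ z₀ (mFourierCoeff (EuclideanSpace.complexify ∘ G) k₀)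
    have h2 : (⟪z₀, -(((4 * Real.pi ^ 2 * Torus.freqNormSq k₀ : ℝ) : ℂ) • (mFourierCoeff (EuclideanSpace.complexify ∘ G) k₀))⟫_ℂ).re ≤
        4 * Real.pi ^ 2 * Torus.freqNormSq k₀ * ‖z₀‖ * ‖g‖ :=
      ((le_abs_self _).trans h1).trans (mul_le_mul_of_nonneg_left hGk (by have := Torus.freqNormSq_nonneg k₀; positivity))
    -- `ν s ≤ 1/(8π²K₀)` so `4π²|k₀|² ν s ≤ 1/2`
    have hνs : ν * s * (8 * Real.pi ^ 2 * (K₀ : ℝ) ^ 2) ≤ 1 := by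
      have e : ν * s * (8 * Real.pi ^ 2 * (K₀ : ℝ) ^ 2) * (1 + 2 * Θ) = s * den := by rw [hdendef]; ring
      have h3 : ν * s * (8 * Real.pi ^ 2 * (K₀ : ℝ) ^ 2) * (1 + 2 * Θ) ≤ 1 := by rw [e, hsden]; exact hσ1
      have h4 : ν * s * (8 * Real.pi ^ 2 * (K₀ : ℝ) ^ 2) * 1 ≤ ν * s * (8 * Real.pi ^ 2 * (K₀ : ℝ) ^ 2) * (1 + 2 * Θ) :=
        mul_le_mul_of_nonneg_left (by linarith only [hΘ]) (by positivity)
      linarith only [h3, h4]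
    have hkK : Torus.freqNormSq k₀ ≤ (K₀ : ℝ) ^ 2 := hkL
    calc ν * (⟪z₀, -(((4 * Real.pi ^ 2 * Torus.freqNormSq k₀ : ℝ) : ℂ) • (mFourierCoeff (EuclideanSpace.complexify ∘ G) k₀))⟫_ℂ).re
        ≤ ν * (4 * Real.pi ^ 2 * Torus.freqNormSq k₀ * ‖z₀‖ * ‖g‖) := mul_le_mul_of_nonneg_left h2 hν.le
      _ = (ν * s * (8 * Real.pi ^ 2 * Torus.freqNormSq k₀)) / 2 * (φ * ‖g‖) := by rw [hzn]; ring
      _ ≤ (ν * s * (8 * Real.pi ^ 2 * (K₀ : ℝ) ^ 2)) / 2 * (φ * ‖g‖) := by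
          apply mul_le_mul_of_nonneg_right _ (mul_nonneg hφ.le (norm_nonneg g))
          apply div_le_div_of_nonneg_right _ zero_le_two
          exact mul_le_mul_of_nonneg_left (mul_le_mul_of_nonneg_left hkK (by positivity)) (mul_nonneg hν.le hs0.le)
      _ ≤ 1 / 2 * (φ * ‖g‖) :=
          mul_le_mul_of_nonneg_right (div_le_div_of_nonneg_right hνs zero_le_two) (mul_nonneg hφ.le (norm_nonneg g))
      _ ≤ φ * ‖g‖ := by
          have h0 := mul_nonneg hφ.le (norm_nonneg g)
          linarith only [h0]
  /- the deficit of the laminar ray: `−2θ₁P₀ − (1+2Θ)·ν·2·4π²K₀²‖z₀‖² ≥ θσφ²/den` -/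
  have hdef : θ * σ * φ ^ 2 / den ≤
      -(2 * θ₁ * (⟪z₀, (mFourierCoeff (EuclideanSpace.complexify ∘ f) k₀)⟫_ℂ).re) -
        (1 + 2 * Θ) * (ν * (2 * (4 * Real.pi ^ 2 * ((K₀ : ℕ) : ℝ) ^ 2 * ‖z₀‖ ^ 2))) := by
    rw [hP₀, hzn]
    have e1 : (1 + 2 * Θ) * (ν * (2 * (4 * Real.pi ^ 2 * ((K₀ : ℕ) : ℝ) ^ 2 * (s * φ) ^ 2))) = (s * den) * (s * φ ^ 2) := by
      rw [hdendef]; ring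
    have e2 : θ * σ * φ ^ 2 / den = θ * (s * φ ^ 2) := by rw [hsdef]; ring
    rw [e1, e2, hsden]
    have hsφ2 : 0 ≤ s * φ ^ 2 := by positivity
    have hθ₁eq : θ₁ = -θ := by linarith only [hθeq]
    rw [hθ₁eq]
    have hστ := mul_le_mul_of_nonneg_right hσθ hsφ2
    linarith only [hστ]
  have hsφ : s * φ ≤ F / ν := by
    have e' : ν * s * ((8 * Real.pi ^ 2 * (K₀ : ℝ) ^ 2) * (1 + 2 * Θ)) = s * den := by rw [hdendef]; ring
    have h3 : ν * s * ((8 * Real.pi ^ 2 * (K₀ : ℝ) ^ 2) * (1 + 2 * Θ)) ≤ 1 := by rw [e', hsden]; exact hσ1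
    have hpi3 := Real.pi_gt_three
    have hpi9 : (9 : ℝ) ≤ Real.pi ^ 2 := by nlinarith only [hpi3]
    have hK2 : (1 : ℝ) ≤ (K₀ : ℝ) ^ 2 := one_le_pow₀ hK₀1
    have h8a : (1 : ℝ) ≤ 8 * Real.pi ^ 2 * (K₀ : ℝ) ^ 2 := by nlinarith only [hpi9, hK2]
    have h8 : (1 : ℝ) ≤ (8 * Real.pi ^ 2 * (K₀ : ℝ) ^ 2) * (1 + 2 * Θ) := one_le_mul_of_one_le_of_one_le h8a (by linarith only [hΘ])
    have hνs0 : 0 ≤ ν * s := by positivity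
    have hνs1 : ν * s ≤ 1 := (le_mul_of_one_le_right hνs0 h8).trans h3
    rw [le_div_iff₀ hν]
    have := mul_le_mul_of_nonneg_right hνs1 hφ.le
    calc s * φ * ν = ν * s * φ := by ring
      _ ≤ 1 * φ := this
      _ ≤ F := by rw [one_mul]; exact hφF
  have hball1 : (s * φ) ^ 2 ≤ 16 * F ^ 2 / ν ^ 2 := by
    have h0 : 0 ≤ s * φ := by positivity
    calc (s * φ) ^ 2 ≤ (F / ν) ^ 2 := pow_le_pow_left₀ h0 hsφ 2
      _ = F ^ 2 / ν ^ 2 := by rw [div_pow]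
      _ ≤ 16 * F ^ 2 / ν ^ 2 := by
          apply div_le_div_of_nonneg_right _ (sq_nonneg ν)
          linarith only [sq_nonneg F]
  by_cases hg0 : g = 0
  · /- no resolved coefficient: the bare laminar state already violates the floor -/
    have hub1 : Torus.eGradNormSq (((ub : (Torus.energySpace (Fin 3))) : (Lp (EuclideanSpace ℝ (Fin 3)) 2 (volume : Measure (UnitAddTorus (Fin 3))))) : (UnitAddTorus (Fin 3)) → (EuclideanSpace ℝ (Fin 3))) ≠ ⊤ := by
      rw [eGradNormSq_congr_ae' hub]; exact eGradNormSq_modes_ne_top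
    have hub2 : ‖ub‖ ^ 2 ≤ 16 * (∫ x, ‖f x‖ ^ 2) / ν ^ 2 := by
      rw [norm_sq_of_ae hub, ← hFsq]
      refine (integral_norm_sq_modes_le.trans ?_)
      simp only [Fin.sum_univ_one, Matrix.cons_val_fin_one, hzn]
      exact hball1
    have hu' := hu ub
    dsimp only at hu'
    have hfl := hu' hub1 hub2
    have hbare := floor_laminar_bare hf hν Φ₁ hθ₁ hθ₁' ub hub htrans hkL hfl
    rw [← hGdef] at hbare
    have hinj0 : ∫ x, ⟪f x, G x⟫_ℝ ≤ 0 := by rw [hg0, norm_zero, mul_zero] at hfG; exact hfG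
    have hlap0 : ν * (⟪z₀, -(((4 * Real.pi ^ 2 * Torus.freqNormSq k₀ : ℝ) : ℂ) • (mFourierCoeff (EuclideanSpace.complexify ∘ G) k₀))⟫_ℂ).re ≤ 0 := by
      rw [hg0, norm_zero, mul_zero] at hlap; exact hlap
    have hpos : 0 < θ * σ * φ ^ 2 / den := by positivity
    have hprice : (1 + 2 * Θ) * (ν * (4 * Real.pi ^ 2 * ((K₀ : ℕ) : ℝ) ^ 2 * ‖z₀‖ ^ 2)) ≤
        (1 + 2 * Θ) * (ν * (2 * (4 * Real.pi ^ 2 * ((K₀ : ℕ) : ℝ) ^ 2 * ‖z₀‖ ^ 2))) := by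
      have : 0 ≤ (1 + 2 * Θ) * (ν * (4 * Real.pi ^ 2 * ((K₀ : ℕ) : ℝ) ^ 2 * ‖z₀‖ ^ 2)) := by positivity
      linarith only [this]
    linarith only [hbare, hinj0, hlap0, hpos, hprice, hdef, hε₀]
  /- the axis beat over the laminar base -/
  have hq0 : q ≠ 0 := by
    rintro rfl
    apply hg0
    rw [hgdef, hGdef]
    exact fc_grad_zero Φ₁ _
  have hfqN : Torus.freqNormSq q ≤ (N : ℝ) ^ 2 := Torus.mem_freqBall.1 hqmem
  have hfq1' : 1 ≤ Torus.freqNormSq q := Torus.one_le_freqNormSq_of_ne_zero hq0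
  have hN1 : (1 : ℝ) ≤ N := by
    refine le_of_pow_le_pow_left₀ two_ne_zero hN0 ?_
    rw [one_pow]; exact hfq1'.trans hfqN
  have hgt : ((fun j => ((q) j : ℂ)) ⬝ᵥ (WithLp.ofLp (g))) = 0 := by rw [hgdef, hGdef]; exact dotc_fc_grad Φ₁ _ q
  obtain ⟨p, zA, zB, gain, hNp, hNpq, hN5, hLp, hLpq, hsep, hdA, hdB, hBq, hzA, hzB, hbeat, hgain⟩ :=
    axis_beat_data_offset hq0 K₀ hfqN g hg0 hgt hα.le
  obtain ⟨hs1, hs2, hs3, hs4⟩ := hsep k₀ hkj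
  have hp0 : p ≠ 0 := ne_zero_of_freqNormSq_pos (sq_nonneg _) hNp
  have hpq0 : p + q ≠ 0 := ne_zero_of_freqNormSq_pos (sq_nonneg _) hNpq
  have hLm := two_freq_le (p := p) (q := q) hLp hLpq
  rw [hgdef, hGdef] at hbeat
  have hzA' : ‖-zA‖ ≤ α := by rw [norm_neg]; exact hzA
  have hzB' : ‖-zB‖ ≤ α := by rw [norm_neg]; exact hzB
  have hdA' : ((fun j => ((p) j : ℂ)) ⬝ᵥ (WithLp.ofLp (-zA))) = 0 := by rw [dotc_neg_right, hdA, neg_zero]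
  have hdB' : ((fun j => (((p + q)) j : ℂ)) ⬝ᵥ (WithLp.ofLp (-zB))) = 0 := by rw [dotc_neg_right, hdB, neg_zero]
  have hBq' : ((fun j => ((q) j : ℂ)) ⬝ᵥ (WithLp.ofLp (-zB))) = 0 := by rw [dotc_neg_right, hBq, neg_zero]
  have hbeat' : Real.pi * (conj (((fun j => ((q) j : ℂ)) ⬝ᵥ (WithLp.ofLp (-zA)))) *
      ⟪(mFourierCoeff (EuclideanSpace.complexify ∘ (Φ₁.grad ub)) q), -zB⟫_ℂ).im ≤ -gain := by
    rw [dotc_neg_right, map_neg, inner_neg_right, neg_mul_neg]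
    exact hbeat
  /- the two dressed states and their admissibility -/
  obtain ⟨up, hup⟩ := exists_state ![k₀, p, p + q] ![z₀, zA, zB] (three_base_ne_zero hk0 hp0 hpq0) (three_base_dotc htrans hdA hdB)
  obtain ⟨um, hum⟩ := exists_state ![k₀, p, p + q] ![z₀, -zA, -zB] (three_base_ne_zero hk0 hp0 hpq0) (three_base_dotc htrans hdA' hdB')
  have h2α : α + α ≤ F / ν := by
    rw [le_div_iff₀ hν]
    have := (le_div_iff₀ (by positivity : (0:ℝ) < 2 * α)).1 hνa
    linarith only [this]
  have hball : (s * φ + (α + α)) ^ 2 ≤ 16 * F ^ 2 / ν ^ 2 := by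
    have h1 : s * φ + (α + α) ≤ 2 * (F / ν) := by linarith only [hsφ, h2α]
    have h0 : 0 ≤ s * φ + (α + α) := by positivity
    calc (s * φ + (α + α)) ^ 2 ≤ (2 * (F / ν)) ^ 2 := pow_le_pow_left₀ h0 h1 2
      _ = 4 * F ^ 2 / ν ^ 2 := by rw [mul_pow, div_pow]; ring
      _ ≤ 16 * F ^ 2 / ν ^ 2 := by
          apply div_le_div_of_nonneg_right _ (sq_nonneg ν)
          linarith only [sq_nonneg F]
  have hup1 : Torus.eGradNormSq (((up : (Torus.energySpace (Fin 3))) : (Lp (EuclideanSpace ℝ (Fin 3)) 2 (volume : Measure (UnitAddTorus (Fin 3))))) : (UnitAddTorus (Fin 3)) → (EuclideanSpace ℝ (Fin 3))) ≠ ⊤ := by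
    rw [eGradNormSq_congr_ae' hup]; exact eGradNormSq_modes_ne_top
  have hum1 : Torus.eGradNormSq (((um : (Torus.energySpace (Fin 3))) : (Lp (EuclideanSpace ℝ (Fin 3)) 2 (volume : Measure (UnitAddTorus (Fin 3))))) : (UnitAddTorus (Fin 3)) → (EuclideanSpace ℝ (Fin 3))) ≠ ⊤ := by
    rw [eGradNormSq_congr_ae' hum]; exact eGradNormSq_modes_ne_top
  have hsum : ∑ m, ‖(![z₀, zA, zB] : Fin 3 → (EuclideanSpace ℂ (Fin 3))) m‖ ≤ s * φ + (α + α) := by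
    simp only [Fin.sum_univ_three, Matrix.cons_val_zero, Matrix.cons_val_one, Matrix.cons_val_two,
      Matrix.head_cons, Matrix.tail_cons, hzn]
    linarith only [hzA, hzB]
  have hsum0 : 0 ≤ ∑ m, ‖(![z₀, zA, zB] : Fin 3 → (EuclideanSpace ℂ (Fin 3))) m‖ := Finset.sum_nonneg fun m _ => norm_nonneg _
  have hsum' : ∑ m, ‖(![z₀, -zA, -zB] : Fin 3 → (EuclideanSpace ℂ (Fin 3))) m‖ ≤ s * φ + (α + α) := by
    simp only [Fin.sum_univ_three, Matrix.cons_val_zero, Matrix.cons_val_one, Matrix.cons_val_two,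
      Matrix.head_cons, Matrix.tail_cons, hzn, norm_neg]
    linarith only [hzA, hzB]
  have hsum0' : 0 ≤ ∑ m, ‖(![z₀, -zA, -zB] : Fin 3 → (EuclideanSpace ℂ (Fin 3))) m‖ := Finset.sum_nonneg fun m _ => norm_nonneg _
  have hup2 : ‖up‖ ^ 2 ≤ 16 * (∫ x, ‖f x‖ ^ 2) / ν ^ 2 := by
    rw [norm_sq_of_ae hup, ← hFsq]
    exact (integral_norm_sq_modes_le.trans (pow_le_pow_left₀ hsum0 hsum 2)).trans hball
  have hum2 : ‖um‖ ^ 2 ≤ 16 * (∫ x, ‖f x‖ ^ 2) / ν ^ 2 := by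
    rw [norm_sq_of_ae hum, ← hFsq]
    exact (integral_norm_sq_modes_le.trans (pow_le_pow_left₀ hsum0' hsum' 2)).trans hball
  /- the FLOOR at the dressed state, sign chosen -/
  have hmain : gain + ε₀ - 2 * θ₁ * (⟪z₀, (mFourierCoeff (EuclideanSpace.complexify ∘ f) k₀)⟫_ℂ).re ≤
      (∫ x, ⟪f x, Φ₁.grad ub x⟫_ℝ) +
        ν * (⟪z₀, -(((4 * Real.pi ^ 2 * Torus.freqNormSq k₀ : ℝ) : ℂ) • (mFourierCoeff (EuclideanSpace.complexify ∘ (Φ₁.grad ub)) k₀))⟫_ℂ).re +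
        (1 + 2 * Θ) * (ν * (2 * (4 * Real.pi ^ 2 * ((K₀ : ℕ) : ℝ) ^ 2 * ‖z₀‖ ^ 2) +
          2 * (4 * Real.pi ^ 2 * (((4 * N + 1 + 2 * K₀ : ℕ)) : ℝ) ^ 2 * (α + α) ^ 2))) := by
    by_cases hP : 0 ≤ (⟪zA, (mFourierCoeff (EuclideanSpace.complexify ∘ f) p)⟫_ℂ).re + (⟪zB, (mFourierCoeff (EuclideanSpace.complexify ∘ f) (p + q))⟫_ℂ).re
    · have hu' := hu up
      dsimp only at hu'
      have hfl := hu' hup1 hup2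
      exact floor_beat_laminar hf hν Φ₁ hband hθ₁ hθ₁' up ub hup hub htrans hdA hdB hBq hzA hzB hNp hNpq hN5
        hs1 hs2 hs3 hs4 hkL hLm hbeat hP hfl
    · have hP' : 0 ≤ (⟪-zA, (mFourierCoeff (EuclideanSpace.complexify ∘ f) p)⟫_ℂ).re + (⟪-zB, (mFourierCoeff (EuclideanSpace.complexify ∘ f) (p + q))⟫_ℂ).re := by
        rw [inner_neg_left, inner_neg_left, Complex.neg_re, Complex.neg_re]
        linarith only [not_le.1 hP]
      have hu' := hu um
      dsimp only at hu'
      have hfl := hu' hum1 hum2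
      exact floor_beat_laminar hf hν Φ₁ hband hθ₁ hθ₁' um ub hum hub htrans hdA' hdB' hBq' hzA' hzB' hNp hNpq hN5
        hs1 hs2 hs3 hs4 hkL hLm hbeat' hP' hfl
  /- the endgame -/
  rw [← hGdef] at hmain
  have eL : ((((4 * N + 1 + 2 * K₀ : ℕ)) : ℝ)) = 4 * (N : ℝ) + 1 + 2 * K₀ := by push_cast; ring
  rw [eL] at hmain
  have hνN : ν * (N : ℝ) ^ 2 ≤ C' ^ 2 * ν ^ (1 - 2 * (3 / 4 : ℝ)) := nu_mul_sq_le hν hN0 (by rwa [show -(3 / 4 : ℝ) = -(3/4 : ℝ) from rfl] at hNs)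
  obtain ⟨hr1, hr2⟩ := rpow_half_facts hν
  have eexp : (1 - 2 * (3 / 4 : ℝ)) = -(1 / 2 : ℝ) := by norm_num
  rw [eexp] at hνN
  -- waves price through `ν N²`
  have hL : 4 * (N : ℝ) + 1 + 2 * K₀ ≤ c * N := by rw [hcdef]; nlinarith only [hN1, hK₀1]
  have hwaves : (1 + 2 * Θ) * (ν * (2 * (4 * Real.pi ^ 2 * (4 * (N : ℝ) + 1 + 2 * K₀) ^ 2 * (α + α) ^ 2))) ≤
      32 * Real.pi ^ 2 * (1 + 2 * Θ) * (c ^ 2 * (C' ^ 2 * ν ^ (-(1 / 2 : ℝ)))) * α ^ 2 := by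
    have h1 : (4 * (N : ℝ) + 1 + 2 * K₀) ^ 2 ≤ (c * N) ^ 2 := pow_le_pow_left₀ (by positivity) hL 2
    have h2 : ν * (c * N) ^ 2 ≤ c ^ 2 * (C' ^ 2 * ν ^ (-(1 / 2 : ℝ))) := by
      calc ν * (c * N) ^ 2 = c ^ 2 * (ν * (N : ℝ) ^ 2) := by ring
        _ ≤ c ^ 2 * (C' ^ 2 * ν ^ (-(1 / 2 : ℝ))) := mul_le_mul_of_nonneg_left hνN (sq_nonneg c)
    have hΘ1 : 0 ≤ 1 + 2 * Θ := by linarith only [hΘ]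
    calc (1 + 2 * Θ) * (ν * (2 * (4 * Real.pi ^ 2 * (4 * (N : ℝ) + 1 + 2 * K₀) ^ 2 * (α + α) ^ 2)))
        = (1 + 2 * Θ) * (32 * Real.pi ^ 2 * α ^ 2) * (ν * (4 * (N : ℝ) + 1 + 2 * K₀) ^ 2) := by ring
      _ ≤ (1 + 2 * Θ) * (32 * Real.pi ^ 2 * α ^ 2) * (ν * (c * N) ^ 2) := by
          refine mul_le_mul_of_nonneg_left (mul_le_mul_of_nonneg_left h1 hν.le) (by positivity)
      _ ≤ (1 + 2 * Θ) * (32 * Real.pi ^ 2 * α ^ 2) * (c ^ 2 * (C' ^ 2 * ν ^ (-(1 / 2 : ℝ)))) :=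
          mul_le_mul_of_nonneg_left h2 (by positivity)
      _ = 32 * Real.pi ^ 2 * (1 + 2 * Θ) * (c ^ 2 * (C' ^ 2 * ν ^ (-(1 / 2 : ℝ)))) * α ^ 2 := by ring
  have hmain' : gain + ε₀ + θ * σ * φ ^ 2 / ((1 + 2 * Θ) * (8 * Real.pi ^ 2) * (K₀ : ℝ) ^ 2 * ν) ≤
      (∫ x, ⟪f x, G x⟫_ℝ) + ν * (⟪z₀, -(((4 * Real.pi ^ 2 * Torus.freqNormSq k₀ : ℝ) : ℂ) • (mFourierCoeff (EuclideanSpace.complexify ∘ G) k₀))⟫_ℂ).re +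
        (1 + 2 * Θ) * (ν * (2 * (4 * Real.pi ^ 2 * (4 * (N : ℝ) + 1 + 2 * K₀) ^ 2 * (α + α) ^ 2))) := by
    rw [← hdendef]
    have e : (1 + 2 * Θ) * (ν * (2 * (4 * Real.pi ^ 2 * ((K₀ : ℕ) : ℝ) ^ 2 * ‖z₀‖ ^ 2) +
          2 * (4 * Real.pi ^ 2 * (4 * (N : ℝ) + 1 + 2 * K₀) ^ 2 * (α + α) ^ 2))) =
        (1 + 2 * Θ) * (ν * (2 * (4 * Real.pi ^ 2 * ((K₀ : ℕ) : ℝ) ^ 2 * ‖z₀‖ ^ 2))) +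
          (1 + 2 * Θ) * (ν * (2 * (4 * Real.pi ^ 2 * (4 * (N : ℝ) + 1 + 2 * K₀) ^ 2 * (α + α) ^ 2))) := by ring
    rw [e] at hmain
    linarith only [hmain, hdef]
  have hend := endgame_weights (c := c) (Y := C' ^ 2 * ν ^ (-(1 / 2 : ℝ))) hν hΘ hK₀1 (norm_nonneg g) hε₀
    hmain' hgain hα2 hfG hlap hwaves
  -- `θ σ ≤ M ν^{1/2}`
  have hkey : θ * σ ≤ M * ν ^ (1 / 2 : ℝ) := by
    have e : (1 + 2 * Θ) ^ 2 * (256 * Real.pi ^ 4) * (K₀ : ℝ) ^ 2 * c ^ 2 * α ^ 2 * (ν * (C' ^ 2 * ν ^ (-(1 / 2 : ℝ)))) =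
        (M * φ ^ 2) * ν ^ (1 / 2 : ℝ) := by
      rw [hMdef, hΘeq, ← hr1]
      field_simp
    rw [e] at hend
    have hφ2 : 0 < φ ^ 2 := by positivity
    have : θ * σ * φ ^ 2 ≤ (M * ν ^ (1 / 2 : ℝ)) * φ ^ 2 := by linarith only [hend]
    exact le_of_mul_le_mul_right this hφ2
  have hνhalf : 0 < ν ^ (1 / 2 : ℝ) := Real.rpow_pos_of_pos hν _
  have hνq : 0 < ν ^ (1 / 4 : ℝ) := Real.rpow_pos_of_pos hν _
  by_cases hθ1 : θ ≤ 1
  · -- `σ = θ`: `θ² ≤ M ν^{1/2}` so `θ ≤ √M ν^{1/4} < K ν^{1/4}`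
    have hσeq : σ = θ := by rw [hσdef]; exact min_eq_left hθ1
    rw [hσeq] at hkey
    have h1 : θ ≤ Real.sqrt (M * ν ^ (1 / 2 : ℝ)) := by
      rw [← Real.sqrt_sq hθpos.le]
      exact Real.sqrt_le_sqrt (by rw [pow_two]; exact hkey)
    rw [Real.sqrt_mul hM0.le, hr2] at h1
    have h2 : Real.sqrt M * ν ^ (1 / 4 : ℝ) < (Real.sqrt M + 1) * ν ^ (1 / 4 : ℝ) := by linarith only [hνq]
    linarith only [hcon, h1, h2]
  · -- `σ = 1`: `1 < θ ≤ M ν^{1/2} < 1`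
    have hθ1' : 1 < θ := lt_of_not_ge hθ1
    have hσeq : σ = 1 := by rw [hσdef]; exact min_eq_right hθ1'.le
    rw [hσeq, mul_one] at hkey
    -- `ν < 1/(M+1)²` gives `ν^{1/2} < 1/(M+1)`
    have h1 : ν ^ (1 / 2 : ℝ) < 1 / (M + 1) := by
      have h := Real.rpow_lt_rpow hν.le hνb (by norm_num : (0:ℝ) < 1 / 2)
      rw [show (1 / (M + 1) ^ 2 : ℝ) = (1 / (M + 1)) ^ (2 : ℝ) by
        rw [Real.rpow_two]; field_simp, ← Real.rpow_mul (by positivity)] at h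
      norm_num at h
      simpa only [one_div] using h
    have h2 : M * ν ^ (1 / 2 : ℝ) < M * (1 / (M + 1)) := mul_lt_mul_of_pos_left h1 hM0
    have h3 : M * (1 / (M + 1)) < 1 := by
      rw [mul_one_div, div_lt_one (by linarith only [hM0])]
      exact lt_add_one M
    linarith only [hkey, hθ1', h2, h3]

end Summit.AnomalousDissipation.AnomalousDissipation.Theorems.KolmogorovFloor.Negative
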